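import Summits.CriticalPhenomena.PercolationContinuityZ3.Theorems.PercNearOneGluingNoHeavyLowerTailSunflowerLawRegion
import Summits.CriticalPhenomena.PercolationContinuityZ3.Theorems.PercNearOneGluingNoHeavyLowerTailSunflowerSafeFactor
import Summits.CriticalPhenomena.PercolationContinuityZ3.Theorems.PercNearOneGluingNoHeavyLowerTailSunflowerCloneGamma
import HarnessLib

/-!
# `NoHeavyLowerTail` (crux stmt-CriticalPhenomena-4575), abstract sunflower cubic at LAW level: the cells of a θ-JOIN are the law-level
# join of the cells, so (C1-law)'s region `W` is inherited by disjoint unions; Gladkov's inequality for the cells of every sunflower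

Support file (seat `prim-ineq-gen-2` gen 30; `--supports stmt-CriticalPhenomena-4575`).  Nothing is asserted about the crux; no `sorry`, no named
facts, standard axioms.  Memo: run/shared/lean/prim/prim-ineq-gen-2/LAW-REGION-GEN30.md §3.  After `…SunflowerLawRegion` (the algebra: `joinLaw`,
`regionW`, `inW_joinLaw`), gen 27's `…SunflowerSafeFactor` (`Sunflower.join`, `lab_join`) and prim-l12-p2's `…SunflowerCloneLaw`/`…CloneGamma`
(`mass`, `wP`, `setSunflower`).

RESULTS [this work]:
* `Sunflower.massVec F p` — the cell vector `(mass 0, …, mass 4)` of a finitary sunflower under the product weights `p : α → ℝ`;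
  `massVec_nonneg`, `total_massVec` (`= 1`).
* **`massVec_join`**: `(F.join G).massVec (Sum.elim p q) = joinLaw (F.massVec p) (G.massVec q)` — the law of a disjoint union is the
  law-level join of the laws (sum over `2^{α ⊕ β} ≃ 2^α × 2^β`, `wP` factorises, `lab_join`, and the 25-case table of the `M₃`-join).
* `AGform_massVec_nonneg` — Gladkov's inequality `ab ≥ e₂(c)` for the cells of EVERY finitary sunflower and every `p ∈ [0,1]^α`
  (transported from the tree's `prodBernoulli_strongHarris_sunflower_three` through `setSunflower`/`mass_setSunflower` in reverse: here we go
  the direct way, from `F : Sunflower α` to the set-level sunflower `(↑) ⁻¹'`-events, `massVec_eq_cells`).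
* **`massVec_join_mem_regionW`**: if the laws of `F` and `G` lie in `W = {max(LA,LB) ≥ 0}` then so does the law of `F.join G` — (C1-law) is
  closed under disjoint unions of sunflowers (coloured hypergraphs / graphs with marks), at every `p`.
-/

noncomputable section

namespace Summit.CriticalPhenomena.PercolationContinuityZ3.Theorems.SunflowerPartition

open Finset LawPencil LawRegion

variable {α β : Type*} [Fintype α] [DecidableEq α] [Fintype β] [DecidableEq β]

/-! ## The cell vector of a finitary sunflower under product weights -/

/-- The cell vector `v ↦ mass F.lab p v` of a finitary sunflower under the product weights `p`. [this work] -/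
def Sunflower.massVec (F : Sunflower α) (p : α → ℝ) : Fin 5 → ℝ := fun v => mass F.lab p v

/-- Unfolding `massVec`. [this work] -/
theorem Sunflower.massVec_apply (F : Sunflower α) (p : α → ℝ) (v : Fin 5) : F.massVec p v = mass F.lab p v := rfl

/-- Product weights are nonnegative for `p ∈ [0,1]^α`. [folklore] -/
theorem wP_nonneg {p : α → ℝ} (hp : ∀ x, 0 ≤ p x ∧ p x ≤ 1) (S : Finset α) : 0 ≤ wP p S := by
  unfold wP
  refine prod_nonneg fun x _ => ?_
  split_ifs
  · exact (hp x).1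
  · linarith [(hp x).2]

/-- The product weights sum to one. [folklore] -/
theorem sum_wP_eq_one (p : α → ℝ) : ∑ S : Finset α, wP p S = 1 := by
  have h := Finset.prod_add (fun x : α => p x) (fun x => 1 - p x) univ
  simp only [add_sub_cancel, prod_const_one] at h
  -- `h : 1 = ∑ t ∈ univ.powerset, (∏ i ∈ t, p i) * ∏ i ∈ univ \ t, (1 - p i)`
  refine Eq.trans ?_ h.symm
  rw [← powerset_univ]
  refine sum_congr rfl fun S _ => ?_
  unfold wP
  rw [← prod_sdiff (subset_univ S), mul_comm]
  congr 1
  · exact prod_congr rfl fun x hx => by rw [if_pos hx]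
  · exact prod_congr rfl fun x hx => by rw [if_neg (mem_sdiff.1 hx).2]

/-- Cells are nonnegative for `p ∈ [0,1]^α`. [this work] -/
theorem Sunflower.massVec_nonneg (F : Sunflower α) {p : α → ℝ} (hp : ∀ x, 0 ≤ p x ∧ p x ≤ 1) : ∀ v, 0 ≤ F.massVec p v := by
  intro v
  unfold Sunflower.massVec mass
  exact sum_nonneg fun S _ => by split_ifs <;> [exact wP_nonneg hp S; exact le_rfl]

/-- The cells sum to one. [this work] -/
theorem Sunflower.total_massVec (F : Sunflower α) (p : α → ℝ) : total (F.massVec p) = 1 := by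
  have h := sum_wP_lab F.lab p (fun _ => 1)
  simp only [mul_one] at h
  rw [sum_wP_eq_one] at h
  unfold total Sunflower.massVec
  rw [Fin.sum_univ_five] at h
  linarith

/-! ## The law of a join -/

/-- Product weights on `α ⊕ β` factorise. [this work] -/
theorem wP_sumElim (p : α → ℝ) (q : β → ℝ) (S : Finset (α ⊕ β)) :
    wP (Sum.elim p q) S = wP p S.toLeft * wP q S.toRight := by
  unfold wP
  rw [Fintype.prod_sum_type]
  congr 1
  · exact prod_congr rfl fun x _ => by simp only [mem_toLeft, Sum.elim_inl]
  · exact prod_congr rfl fun x _ => by simp only [mem_toRight, Sum.elim_inr]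

/-- The 25-case table: pushing `x ⊗ y` forward under the `M₃`-join gives `joinLaw`. [this work] -/
theorem sum_joinM_eq_joinLaw (x y : Fin 5 → ℝ) (v : Fin 5) :
    ∑ a : Fin 5, ∑ b : Fin 5, (if joinM a b = v then x a * y b else 0) = joinLaw x y v := by
  fin_cases v <;> simp [Fin.sum_univ_five, joinM] <;> ring

/-- **THE LAW OF A θ-JOIN IS THE LAW-LEVEL JOIN OF THE LAWS.** [this work] -/
theorem Sunflower.massVec_join (F : Sunflower α) (G : Sunflower β) (p : α → ℝ) (q : β → ℝ) :
    (F.join G).massVec (Sum.elim p q) = joinLaw (F.massVec p) (G.massVec q) := by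
  ext v
  rw [← sum_joinM_eq_joinLaw]
  calc (F.join G).massVec (Sum.elim p q) v
      = ∑ S : Finset (α ⊕ β), (if (F.join G).lab S = v then wP (Sum.elim p q) S else 0) := rfl
    _ = ∑ T : Finset α, ∑ U : Finset β, (if joinM (F.lab T) (G.lab U) = v then wP p T * wP q U else 0) := by
        rw [Fintype.sum_equiv Finset.sumEquiv.toEquiv _
          (fun TU : Finset α × Finset β => if joinM (F.lab TU.1) (G.lab TU.2) = v then wP p TU.1 * wP q TU.2 else 0) ?_,
          Fintype.sum_prod_type]
        intro S
        change (if (F.join G).lab S = v then wP (Sum.elim p q) S else 0) =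
          (if joinM (F.lab S.toLeft) (G.lab S.toRight) = v then wP p S.toLeft * wP q S.toRight else 0)
        rw [Sunflower.lab_join, wP_sumElim]
    _ = ∑ T : Finset α, wP p T * ∑ U : Finset β, wP q U * (if joinM (F.lab T) (G.lab U) = v then 1 else 0) := by
        refine sum_congr rfl fun T _ => ?_
        rw [mul_sum]
        refine sum_congr rfl fun U _ => ?_
        split_ifs <;> simp
    _ = ∑ T : Finset α, wP p T * ∑ b : Fin 5, mass G.lab q b * (if joinM (F.lab T) b = v then 1 else 0) := by
        refine sum_congr rfl fun T _ => ?_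
        rw [sum_wP_lab G.lab q (fun b => if joinM (F.lab T) b = v then 1 else 0)]
    _ = ∑ a : Fin 5, mass F.lab p a * ∑ b : Fin 5, mass G.lab q b * (if joinM a b = v then 1 else 0) :=
        sum_wP_lab F.lab p (fun a => ∑ b : Fin 5, mass G.lab q b * (if joinM a b = v then 1 else 0))
    _ = ∑ a : Fin 5, ∑ b : Fin 5, (if joinM a b = v then F.massVec p a * G.massVec q b else 0) := by
        refine sum_congr rfl fun a _ => ?_
        rw [mul_sum]
        refine sum_congr rfl fun b _ => ?_
        simp only [Sunflower.massVec_apply]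
        split_ifs <;> simp

/-! ## Gladkov's inequality for the cells of a finitary sunflower -/

section Gladkov

open MeasureTheory Literature.Probability.LatticeModels Literature.Probability.Percolation

/-- The set-level up-set of a finitary up-set family: `{ω : Set α | ω.toFinset ∈ V}`. [this work] -/
def upSet (V : Finset (Finset α)) : Set (Set α) := {ω | ∃ S ∈ V, (↑S : Set α) = ω}

omit [Fintype α] [DecidableEq α] in
/-- Membership of a coerced finset in `upSet V`. [this work] -/
theorem coe_mem_upSet {V : Finset (Finset α)} {S : Finset α} : (↑S : Set α) ∈ upSet V ↔ S ∈ V := by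
  constructor
  · rintro ⟨T, hT, h⟩
    rwa [← Finset.coe_inj.1 h]
  · intro h; exact ⟨S, h, rfl⟩

omit [DecidableEq α] in
/-- `upSet` of an up-set family is an up-set of `Set α`. [this work] -/
theorem isUpperSet_upSet {V : Finset (Finset α)} (hV : IsUpperSet (V : Set (Finset α))) : IsUpperSet (upSet V) := by
  intro ω ω' hle hω
  obtain ⟨S, hS, rfl⟩ := hω
  classical
  refine ⟨ω'.toFinset, ?_, by simp⟩
  refine hV (show S ≤ ω'.toFinset from ?_) hS
  intro x hx
  rw [Set.mem_toFinset]
  exact hle hx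

omit [Fintype α] in
/-- The pairwise intersections of the `upSet`s of a sunflower are the `upSet` of the kernel. [this work] -/
theorem upSet_inter (F : Sunflower α) {i j : Fin 3} (hij : i ≠ j) : upSet (F.V i) ∩ upSet (F.V j) = upSet F.A := by
  ext ω
  constructor
  · rintro ⟨⟨S, hS, rfl⟩, hj⟩
    rw [coe_mem_upSet] at hj
    exact ⟨S, F.mem_A_of_mem_mem hij hS hj, rfl⟩
  · rintro ⟨S, hS, rfl⟩
    have h := hS
    unfold Sunflower.A at h
    rw [← F.inter_eq i j hij, mem_inter] at h
    exact ⟨⟨S, h.1, rfl⟩, ⟨S, h.2, rfl⟩⟩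

/-- The SET-LEVEL VERSION of a finitary sunflower: prim-l12-p2's `setSunflower` of the three `upSet`s. [this work] -/
def Sunflower.setVersion (F : Sunflower α) : Sunflower α :=
  setSunflower (upSet (F.V 0)) (upSet (F.V 1)) (upSet (F.V 2)) (isUpperSet_upSet (F.upper 0)) (isUpperSet_upSet (F.upper 1))
    (isUpperSet_upSet (F.upper 2)) (upSet_inter F (by decide : (0 : Fin 3) ≠ 1)) (upSet_inter F (by decide : (0 : Fin 3) ≠ 2)) (upSet_inter F (by decide : (1 : Fin 3) ≠ 2))

/-- The set-level version has the same three up-set families. [this work] -/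
theorem Sunflower.V_setVersion (F : Sunflower α) : F.setVersion.V = F.V := by
  funext i
  ext S
  fin_cases i <;> simp [Sunflower.setVersion, setSunflower, coe_mem_upSet]

/-- The set-level version has the same labelling. [this work] -/
theorem Sunflower.lab_setVersion (F : Sunflower α) : F.setVersion.lab = F.lab := by
  funext S
  unfold Sunflower.lab Sunflower.A
  rw [Sunflower.V_setVersion]

/-- **The cells of a finitary sunflower are the `prodBernoulli` cells** of its set-level version (for `p ∈ [0,1]^α`). [this work] -/
theorem Sunflower.massVec_eq_cells (F : Sunflower α) (p : α → unitInterval) :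
    F.massVec (fun x => (p x : ℝ)) = cells p (upSet (F.V 0)) (upSet (F.V 1)) (upSet (F.V 2)) (upSet F.A) := by
  obtain ⟨e4, e0, e1, e2, e3⟩ := mass_setSunflower (isUpperSet_upSet (F.upper 0)) (isUpperSet_upSet (F.upper 1))
    (isUpperSet_upSet (F.upper 2)) (upSet_inter F (by decide : (0 : Fin 3) ≠ 1)) (upSet_inter F (by decide : (0 : Fin 3) ≠ 2)) (upSet_inter F (by decide : (1 : Fin 3) ≠ 2)) p
  change mass F.setVersion.lab (fun x => (p x : ℝ)) 4 = (prodBernoulli p).real (upSet F.A) at e4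
  change mass F.setVersion.lab (fun x => (p x : ℝ)) 0 = (prodBernoulli p).real (upSet (F.V 0) ∪ upSet (F.V 1) ∪ upSet (F.V 2))ᶜ
    at e0
  change mass F.setVersion.lab (fun x => (p x : ℝ)) 1 = (prodBernoulli p).real (upSet (F.V 0) \ upSet F.A) at e1
  change mass F.setVersion.lab (fun x => (p x : ℝ)) 2 = (prodBernoulli p).real (upSet (F.V 1) \ upSet F.A) at e2
  change mass F.setVersion.lab (fun x => (p x : ℝ)) 3 = (prodBernoulli p).real (upSet (F.V 2) \ upSet F.A) at e3
  rw [Sunflower.lab_setVersion] at e4 e0 e1 e2 e3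
  ext v
  fin_cases v
  · show F.massVec _ 0 = cells p _ _ _ _ 0
    rw [cells_apply_zero]; exact e0
  · show F.massVec _ 1 = cells p _ _ _ _ 1
    rw [cells_apply_one]; exact e1
  · show F.massVec _ 2 = cells p _ _ _ _ 2
    rw [cells_apply_two]; exact e2
  · show F.massVec _ 3 = cells p _ _ _ _ 3
    rw [cells_apply_three]; exact e3
  · show F.massVec _ 4 = cells p _ _ _ _ 4
    rw [cells_apply_four]; exact e4

/-- **Gladkov's inequality for every finitary sunflower**: `AG(massVec) ≥ 0` for `p ∈ [0,1]^α`. [Literature (Gladkov / strong Harris),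
transported] -/
theorem Sunflower.AGform_massVec_nonneg (F : Sunflower α) {p : α → ℝ} (hp : ∀ x, 0 ≤ p x ∧ p x ≤ 1) :
    0 ≤ AGform (F.massVec p) := by
  set p' : α → unitInterval := fun x => ⟨p x, (hp x).1, (hp x).2⟩ with hp'
  have hpp : (fun x => (p' x : ℝ)) = p := by funext x; rfl
  rw [← hpp, F.massVec_eq_cells p']
  exact AGform_cells_nonneg p' (isUpperSet_upSet (F.upper 0)) (isUpperSet_upSet (F.upper 1)) (isUpperSet_upSet (F.upper 2))
    (upSet_inter F (by decide : (0 : Fin 3) ≠ 1)) (upSet_inter F (by decide : (0 : Fin 3) ≠ 2)) (upSet_inter F (by decide : (1 : Fin 3) ≠ 2))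

end Gladkov

/-! ## (C1-law) is inherited by disjoint unions -/

/-- **The law region `W` is inherited by θ-joins**: if the laws of `F` (under `p`) and `G` (under `q`) lie in `W`, so does the law of the
disjoint union `F.join G` under `Sum.elim p q`. [this work] -/
theorem Sunflower.massVec_join_mem_regionW (F : Sunflower α) (G : Sunflower β) {p : α → ℝ} {q : β → ℝ}
    (hp : ∀ x, 0 ≤ p x ∧ p x ≤ 1) (hq : ∀ x, 0 ≤ q x ∧ q x ≤ 1)
    (hF : F.massVec p ∈ regionW) (hG : G.massVec q ∈ regionW) :
    (F.join G).massVec (Sum.elim p q) ∈ regionW := by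
  rw [F.massVec_join G p q]
  exact inW_joinLaw (F.massVec_nonneg hp) (G.massVec_nonneg hq) (F.AGform_massVec_nonneg hp) (G.AGform_massVec_nonneg hq) hF hG

end Summit.CriticalPhenomena.PercolationContinuityZ3.Theorems.SunflowerPartition
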